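import Summits.Langlands.Langlands.Theorems.SkinnerWilesDefectOneFiveIsogenyEllipticCurvesIntegralFrame
import Summits.Langlands.Langlands.Theorems.SkinnerWilesDefectOneFiveIsogenyEllipticCurvesAdaptedBasis
import Literature.NumberTheory.GaloisRepresentations.LocalKroneckerWeberInertiaProofs
import Literature.NumberTheory.GaloisRepresentations.GaloisRepUnramifiedProofs
import Literature.AlgebraicGeometry.Motives.FaltingsECEndCoreOrdinaryProofs
import HarnessLib

/-!
# The local clause of `ReducibleOrdinaryModular` at a place above `ℓ` for the framed Tate module
(route `SkinnerWilesDefectOne`, item stmt-Langlands-12922 `FiveIsogenyEllipticCurves`, helper)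

The target `ReducibleOrdinaryModular` asks, at every `v ∣ p`, for `p`-distinguishedness of the
integral model `ρ₀` and for an ORIENTED ordinary frame `Q` of `ρ.toLocal v`:
`‖Q₀₀‖ ≤ ‖Q₁₀‖`, `(Q⁻¹ ρ(σ) Q)₁₀ = 0` for all `σ ∈ Γ_{K_v}`, and on the inertia group
`(Q⁻¹ρ(σ)Q)₁₁^m = 1`, `(Q⁻¹ρ(σ)Q)₀₀^m = χ_p(σ)^{(k-1)m}` (here `k = 2`, `m = 1`).  This file derives
that clause (`localClause`) for `ρ = V_ℓ E` framed in a basis `b` with a residually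
upper-triangular integral model `ρ₀`, from the ORDINARY VECTOR `f₀ ∈ V_ℓ E` at `v` (Serre 1968,
IV A.2.2: the line `T_ℓ(Ê)`): `f₀` is an eigenvector of the decomposition group `res(Γ_{K_v})`,
and the local inertia group acts trivially on `V_ℓ E / ℚ_ℓ f₀` — so that, `det = χ_ℓ`, its
eigenvalue on `f₀` is `χ_ℓ` — together with one inertia element `σ₀` at which the residual diagonal
of `ρ₀` is `(1, ≢ 1)` (distinguishedness).  The frame is `Q = ` change of basis from `b` to
`(f₀, f₁)`; the orientation inequality is the tree's `oriented_of_unitRoot_congr_toLocal`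
(`EisensteinProModularSeed.Negative.OrientedFrame`): an ordinary frame whose unit-root entry is
`≡ (ρ₀ σ₀)₀₀` at one distinguished `σ₀` is oriented.  Also here: the prime `𝔓₀ ∣ v` whose
inertia group is the image of the local one (`exists_prime_inertia_eq`, from
`GaloisRepUnramifiedProofs`).

The elliptic-curve section is stated for number fields `K : Type` (universe `0`), as the route's
statements and the tree's `oriented_of_unitRoot_congr_toLocal` are.

References: C. Skinner, A. Wiles, Publ. Math. IHÉS 89 (1999), §4.5 Thm A (hypotheses);
J.-P. Serre (1968), IV A.2.2; J. Neukirch, *Algebraic Number Theory* (1999), II (9.6).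
-/

noncomputable section

-- `Summit.Langlands.Langlands.…`: summit = sub-problem name (D-0017 layout), as in every Theorems file here.
set_option linter.dupNamespace false

open scoped NumberField MatrixGroups Matrix Valued
open Field IsDedekindDomain IsLocalRing NumberField
open Literature.NumberTheory.EllipticCurves Literature.NumberTheory.GaloisRepresentations
open Literature.AlgebraicGeometry.Motives
open Summit.Langlands.Langlands.Theorems.EisensteinProModularSeed.Negative

namespace Summit.Langlands.Langlands.Theorems.FiveIsogenyEllipticCurves

universe u

/-! ### The prime above `v` cut out by the completion -/

section Prime

variable (K : Type u) [Field K] [NumberField K] (v : HeightOneSpectrum (𝓞 K))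

/-- **The prime `𝔓₀ ∣ v` of `\bar ℤ_K` cut out by `K̄ → \bar K_v`, and its inertia group.**  There
is a prime `𝔓₀` above `v` such that restriction `res : Γ_{K_v} → Γ_K` maps the local inertia group
`I_{K_v}` INTO `I_{𝔓₀}` and ONTO it (Neukirch II (9.6); both halves are theorems of the tree,
`absGaloisRestrict_mem_inertia_of_mem_absInertia`, `exists_absGaloisRestrict_eq_of_mem_inertia`).
[cite: NeukirchANT1999, Ch. II §9 Prop. (9.6)] -/
theorem exists_prime_inertia_eq :
    ∃ 𝔓 ∈ v.primesAbove,
      (∀ σ ∈ absInertia (v.adicCompletion K),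
        absGaloisRestrict K (v.adicCompletion K) σ ∈ 𝔓.inertia (absoluteGaloisGroup K)) ∧
      ∀ τ ∈ 𝔓.inertia (absoluteGaloisGroup K), ∃ σ ∈ absInertia (v.adicCompletion K),
        absGaloisRestrict K (v.adicCompletion K) σ = τ := by
  have hw := adicCompletion_valuation_le_one_iff K v
  have hO := norm_algebraMap_ringOfIntegers_le_one K v
  have hv := norm_algebraMap_ringOfIntegers_lt_one_iff K v
  have hd : DenseRange (algebraMap K (v.adicCompletion K)) :=
    IsDedekindDomain.HeightOneSpectrum.denseRange_algebraMap (K := K) (v := v)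
  obtain ⟨𝔓, h𝔓⟩ := exists_ideal_forall_mem_iff_spectralNorm_lt_one K (v.adicCompletion K) hO
  have h𝔓v : 𝔓 ∈ v.primesAbove := mem_primesAbove_of_forall_mem_iff v hv 𝔓 h𝔓
  refine ⟨𝔓, h𝔓v, fun σ hσ => absGaloisRestrict_mem_inertia_of_mem_absInertia hw hO 𝔓 h𝔓 hσ,
    fun τ hτ => ?_⟩
  exact exists_absGaloisRestrict_eq_of_mem_inertia hw hd hO
    (exists_norm_algebraMap_adicCompletion_lt_one K v) 𝔓 h𝔓
    (HeightOneSpectrum.isMaximal_of_mem_primesAbove h𝔓v) hτ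

end Prime

/-! ### Matrices in the ordinary basis -/

section Ordinary

variable {K : Type} [Field K] [NumberField K] (W : WeierstrassCurve K) [W.IsElliptic] (ℓ : ℕ)
  [hℓ : Fact ℓ.Prime]

/-- **Matrix in a basis whose first vector is an eigenvector**: if `A (b' 0) = θ • b' 0` then the
first column of the matrix of `A` in `b'` is `(θ, 0)`. [folklore] -/
theorem toMatrix_col_zero_of_eigen {k : Type*} [Field k] {V : Type*} [AddCommGroup V] [Module k V]
    (b' : Module.Basis (Fin 2) k V) (A : V →ₗ[k] V) {θ : k} (h0 : A (b' 0) = θ • b' 0) :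
    LinearMap.toMatrix b' b' A 1 0 = 0 ∧ LinearMap.toMatrix b' b' A 0 0 = θ := by
  constructor
  · rw [LinearMap.toMatrix_apply, h0, map_smul, Finsupp.smul_apply, Module.Basis.repr_self,
      Finsupp.single_apply]; simp
  · rw [LinearMap.toMatrix_apply, h0, map_smul, Finsupp.smul_apply, Module.Basis.repr_self,
      Finsupp.single_apply]; simp

/-- **… and modulo which it acts trivially**: if moreover `A (b' 1) - b' 1 ∈ k (b' 0)` then the
matrix is `(θ c; 0 1)`, so its lower-right entry is `1` and `det A = θ`. [folklore] -/
theorem toMatrix_one_one_and_det_of_eigen_quot {k : Type*} [Field k] {V : Type*} [AddCommGroup V]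
    [Module k V] (b' : Module.Basis (Fin 2) k V) (A : V →ₗ[k] V) {θ : k} (h0 : A (b' 0) = θ • b' 0)
    (hq : ∃ c : k, A (b' 1) - b' 1 = c • b' 0) :
    LinearMap.toMatrix b' b' A 1 1 = 1 ∧ LinearMap.det A = θ := by
  obtain ⟨c, hc⟩ := hq
  obtain ⟨e10, e00⟩ := toMatrix_col_zero_of_eigen b' A h0
  have hc' : A (b' 1) = b' 1 + c • b' 0 := by rw [← hc]; abel
  have e11 : LinearMap.toMatrix b' b' A 1 1 = 1 := by
    rw [LinearMap.toMatrix_apply, hc', map_add, map_smul, Finsupp.add_apply, Finsupp.smul_apply,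
      Module.Basis.repr_self, Module.Basis.repr_self, Finsupp.single_apply, Finsupp.single_apply]
    simp
  have e01 : LinearMap.toMatrix b' b' A 0 1 = c := by
    rw [LinearMap.toMatrix_apply, hc', map_add, map_smul, Finsupp.add_apply, Finsupp.smul_apply,
      Module.Basis.repr_self, Module.Basis.repr_self, Finsupp.single_apply, Finsupp.single_apply]
    simp
  refine ⟨e11, ?_⟩
  rw [← LinearMap.det_toMatrix b', Matrix.det_fin_two, e00, e11, e10, e01]
  ring

/-- Extending a non-zero vector of a plane to a basis (`exists_basis_eq_of_isUnit_repr_zero` over a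
field: one coordinate is non-zero). [folklore] -/
theorem exists_basis_fst_eq {k : Type*} [Field k] {V : Type*} [AddCommGroup V] [Module k V]
    (b : Module.Basis (Fin 2) k V) {f₀ : V} (hf₀ : f₀ ≠ 0) :
    ∃ b' : Module.Basis (Fin 2) k V, b' 0 = f₀ := by
  by_cases h0 : b.repr f₀ 0 ≠ 0
  · obtain ⟨e, he, -⟩ := exists_basis_eq_of_isUnit_repr_zero b f₀ (Ne.isUnit h0)
    exact ⟨e, he⟩
  · have h1 : b.repr f₀ 1 ≠ 0 := by
      intro h1
      apply hf₀
      rw [← b.sum_repr f₀, Fin.sum_univ_two, not_not.mp h0, h1, zero_smul, zero_smul, add_zero]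
    have h1' : IsUnit ((b.reindex (Equiv.swap 0 1)).repr f₀ 0) := by
      rw [Module.Basis.repr_reindex_apply]
      exact Ne.isUnit h1
    obtain ⟨e, he, -⟩ := exists_basis_eq_of_isUnit_repr_zero (b.reindex (Equiv.swap 0 1)) f₀ h1'
    exact ⟨e, he⟩

/-- **The local clause of `ReducibleOrdinaryModular` at `v` from the ordinary vector.**  Let
`ρ = V_ℓ E` framed in `b` (`framedTateGaloisRepOfBasis`) with a residually upper-triangular integral
model `r₀` over `O = 𝒪_{ℚ̄_ℓ}`, and let `f₀ ≠ 0` be a vector of `V_ℓ E` which is an eigenvector of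
the decomposition group `res(Γ_{K_v})` and modulo which the local inertia group acts trivially
(Serre's ordinary line).  Let `σ₀` be a local inertia element at which the frame entries satisfy
`ρ(σ₀)₀₀ ≡ 1` and `ρ(σ₀)₀₀ ≢ ρ(σ₀)₁₁ (mod 𝔪)`.  Then `r₀` is `ℓ`-distinguished at `v` and the
change of basis `Q` from `b` to `(f₀, f₁)` is an ORIENTED ordinary frame of weight `k = 2`,
exponent `m = 1`: `(Q⁻¹ρ(σ)Q)₁₀ = 0` on `Γ_{K_v}`, and on inertia `(Q⁻¹ρ(σ)Q)₁₁ = 1`,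
`(Q⁻¹ρ(σ)Q)₀₀ = χ_ℓ(σ)` (`det ρ = χ_ℓ`, `det_rationalGaloisRepTate_eq_cyclotomicCharacter`;
local = global cyclotomic character, `cyclotomicCharacter_absGaloisRestrict`); the orientation
`‖Q₀₀‖ ≤ ‖Q₁₀‖` is `oriented_of_unitRoot_congr_toLocal`.
[cite: SkinnerWiles1999, §4.5 Theorem A] -/
theorem localClause {O : ValuationSubring (PadicAlgCl ℓ)}
    (hO : O = (Valued.v : Valuation (PadicAlgCl ℓ) NNReal).valuationSubring)
    (v : HeightOneSpectrum (𝓞 K)) (hℓK : (ℓ : K) ≠ 0)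
    (b : Module.Basis (Fin 2) ℚ_[ℓ] (W.rationalTateModule ℓ))
    {r₀ : absoluteGaloisGroup K →* GL (Fin 2) O}
    (hmod : (W.framedTateGaloisRepOfBasis ℓ (W.continuous_rationalGaloisRepTate_holds ℓ) b
      ).HasUpperTriangularIntegralModel r₀)
    {f₀ : W.rationalTateModule ℓ} (hf₀ : f₀ ≠ 0)
    (hstab : ∀ σ : absoluteGaloisGroup (v.adicCompletion K), ∃ θ : ℚ_[ℓ],
      W.rationalGaloisRepTate ℓ (absGaloisRestrict K (v.adicCompletion K) σ) f₀ = θ • f₀)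
    (hquot : ∀ σ ∈ absInertia (v.adicCompletion K), ∀ y, ∃ c : ℚ_[ℓ],
      W.rationalGaloisRepTate ℓ (absGaloisRestrict K (v.adicCompletion K) σ) y - y = c • f₀)
    {σ₀ : absoluteGaloisGroup (v.adicCompletion K)} (hσ₀ : σ₀ ∈ absInertia (v.adicCompletion K))
    (h00 : Valued.v ((W.framedTateGaloisRepOfBasis ℓ (W.continuous_rationalGaloisRepTate_holds ℓ) b
      (absGaloisRestrict K (v.adicCompletion K) σ₀)).val 0 0 - 1) < 1)
    (hdist : ¬ Valued.v ((W.framedTateGaloisRepOfBasis ℓ (W.continuous_rationalGaloisRepTate_holds ℓ) b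
        (absGaloisRestrict K (v.adicCompletion K) σ₀)).val 0 0 -
      (W.framedTateGaloisRepOfBasis ℓ (W.continuous_rationalGaloisRepTate_holds ℓ) b
        (absGaloisRestrict K (v.adicCompletion K) σ₀)).val 1 1) < 1) :
    IsPDistinguishedAt r₀ v ∧
      ∃ Q : Matrix.GeneralLinearGroup (Fin 2) (PadicAlgCl ℓ),
        Valued.v (Q.val 0 0) ≤ Valued.v (Q.val 1 0) ∧
        ∀ σ, (Q⁻¹ * (W.framedTateGaloisRepOfBasis ℓ (W.continuous_rationalGaloisRepTate_holds ℓ)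
            b).toLocal v σ * Q).val 1 0 = 0 ∧
          (σ ∈ absInertia (v.adicCompletion K) →
            (Q⁻¹ * (W.framedTateGaloisRepOfBasis ℓ (W.continuous_rationalGaloisRepTate_holds ℓ)
              b).toLocal v σ * Q).val 1 1 ^ 1 = 1 ∧
            (Q⁻¹ * (W.framedTateGaloisRepOfBasis ℓ (W.continuous_rationalGaloisRepTate_holds ℓ)
              b).toLocal v σ * Q).val 0 0 ^ 1 =
              algebraMap (Padic ℓ) (PadicAlgCl ℓ)
                (((GaloisRep.cyclotomicCharacter (v.adicCompletion K) ℓ σ).val : PadicInt ℓ) :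
                  Padic ℓ) ^ ((2 - 1) * 1)) := by
  classical
  haveI : NeZero (ℓ : K) := ⟨hℓK⟩
  set ρ := W.framedTateGaloisRepOfBasis ℓ (W.continuous_rationalGaloisRepTate_holds ℓ) b with hρ
  set ρV := W.rationalGaloisRepTate ℓ with hρV
  set res := absGaloisRestrict K (v.adicCompletion K) with hres
  set f : ℚ_[ℓ] →+* PadicAlgCl ℓ := algebraMap ℚ_[ℓ] (PadicAlgCl ℓ) with hf
  -- the basis `(f₀, f₁)` and the change-of-basis frame `Q`
  obtain ⟨b', hb'⟩ := exists_basis_fst_eq b hf₀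
  set P : Matrix (Fin 2) (Fin 2) ℚ_[ℓ] := b.toMatrix b' with hP
  set P' : Matrix (Fin 2) (Fin 2) ℚ_[ℓ] := b'.toMatrix b with hP'
  have hPP' : P * P' = 1 := Module.Basis.toMatrix_mul_toMatrix_flip b b'
  have hP'P : P' * P = 1 := Module.Basis.toMatrix_mul_toMatrix_flip b' b
  obtain ⟨Q, hQ, hQinv⟩ : ∃ Q : Matrix.GeneralLinearGroup (Fin 2) (PadicAlgCl ℓ),
      Q.val = P.map f ∧ (Q⁻¹).val = P'.map f :=
    ⟨⟨P.map f, P'.map f, by rw [← Matrix.map_mul, hPP', Matrix.map_one f (map_zero f) (map_one f)],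
      by rw [← Matrix.map_mul, hP'P, Matrix.map_one f (map_zero f) (map_one f)]⟩, rfl, rfl⟩
  -- conjugated matrices are the matrices in the basis `b'`
  have hconj : ∀ σ, (Q⁻¹ * ρ.toLocal v σ * Q).val =
      (LinearMap.toMatrix b' b' (ρV (res σ))).map f := by
    intro σ
    have e : (ρ.toLocal v σ).val = (LinearMap.toMatrix b b (ρV (res σ))).map f := by
      rw [FramedGaloisRep.toLocal_apply]
      exact W.coe_framedTateGaloisRepOfBasis_apply ℓ _ b (res σ)
    rw [Units.val_mul, Units.val_mul, hQ, hQinv, e, ← Matrix.map_mul, ← Matrix.map_mul, hP, hP',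
      basis_toMatrix_mul_linearMap_toMatrix_mul_basis_toMatrix b' b b' b]
  -- entries
  have hcol : ∀ σ, (Q⁻¹ * ρ.toLocal v σ * Q).val 1 0 = 0 ∧ ∃ θ : ℚ_[ℓ],
      ρV (res σ) f₀ = θ • f₀ ∧ (Q⁻¹ * ρ.toLocal v σ * Q).val 0 0 = f θ := by
    intro σ
    obtain ⟨θ, hθ⟩ := hstab σ
    have h0 : ρV (res σ) (b' 0) = θ • b' 0 := by rw [hb']; exact hθ
    obtain ⟨e10, e00⟩ := toMatrix_col_zero_of_eigen b' (ρV (res σ)) h0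
    refine ⟨?_, θ, hθ, ?_⟩
    · rw [hconj, Matrix.map_apply, e10, map_zero]
    · rw [hconj, Matrix.map_apply, e00]
  have hinert : ∀ σ ∈ absInertia (v.adicCompletion K),
      (Q⁻¹ * ρ.toLocal v σ * Q).val 1 1 = 1 ∧
      (Q⁻¹ * ρ.toLocal v σ * Q).val 0 0 =
        f ((GaloisRep.cyclotomicCharacter (v.adicCompletion K) ℓ σ : ℤ_[ℓ]) : ℚ_[ℓ]) := by
    intro σ hσ
    obtain ⟨-, θ, hθ, h00'⟩ := hcol σ
    have h0 : ρV (res σ) (b' 0) = θ • b' 0 := by rw [hb']; exact hθ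
    have hq : ∃ c : ℚ_[ℓ], ρV (res σ) (b' 1) - b' 1 = c • b' 0 := by
      rw [hb']; exact hquot σ hσ (b' 1)
    obtain ⟨e11, hdet⟩ := toMatrix_one_one_and_det_of_eigen_quot b' (ρV (res σ)) h0 hq
    refine ⟨by rw [hconj, Matrix.map_apply, e11, map_one], ?_⟩
    rw [h00', ← hdet, hρV, det_rationalGaloisRepTate_eq_cyclotomicCharacter W ℓ (res σ), hres,
      cyclotomicCharacter_absGaloisRestrict K (v.adicCompletion K) ℓ σ]
    rfl
  -- residual data at `σ₀`
  have e00 : ((r₀ (res σ₀)).val 0 0 : PadicAlgCl ℓ) = (ρ (res σ₀)).val 0 0 :=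
    (entry_eq_of_integralModel hmod (res σ₀) 0 0).symm
  have e11 : ((r₀ (res σ₀)).val 1 1 : PadicAlgCl ℓ) = (ρ (res σ₀)).val 1 1 :=
    (entry_eq_of_integralModel hmod (res σ₀) 1 1).symm
  have hdist' : (r₀ (res σ₀)).val 0 0 - (r₀ (res σ₀)).val 1 1 ∉ maximalIdeal O := by
    rw [sub_mem_maximalIdeal_iff_v hO, e00, e11]
    exact hdist
  have hunit : ∃ t : O, (t : PadicAlgCl ℓ) = (Q⁻¹ * ρ.toLocal v σ₀ * Q).val 1 1 ∧
      t - (r₀ (res σ₀)).val 0 0 ∈ maximalIdeal O := by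
    refine ⟨1, ?_, ?_⟩
    · rw [(hinert σ₀ hσ₀).1, OneMemClass.coe_one]
    · rw [sub_mem_maximalIdeal_iff_v hO, e00, OneMemClass.coe_one, Valuation.map_sub_swap]
      exact h00
  refine ⟨(isPDistinguishedAt_iff r₀ v).mpr ⟨σ₀, hdist'⟩, Q, ?_, fun σ => ⟨(hcol σ).1, fun hσ => ?_⟩⟩
  · exact oriented_of_unitRoot_congr_toLocal hO hmod v Q σ₀ (hcol σ₀).1 hunit hdist'
  · obtain ⟨h11, h00σ⟩ := hinert σ hσ
    refine ⟨by rw [pow_one, h11], ?_⟩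
    rw [show (2 - 1) * 1 = 1 from rfl, pow_one, pow_one, h00σ]

end Ordinary

end Summit.Langlands.Langlands.Theorems.FiveIsogenyEllipticCurves

end
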